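import Mathlib
import HarnessLib
import Summits.HubbardSuperconductivity.HubbardSuperconductivity.Theorems.KLProgrammeKLRegimeEngineTowerLevNumericsDoors
import Summits.HubbardSuperconductivity.HubbardSuperconductivity.Theorems.KLProgrammeKLRegimeEngineTowerChernoff

/-!
# Route `KLProgramme` — crux K3 ENGINE (stmt-HubbardSuperconductivity-20437 `KLRegimeEngineV17F2`), stub (b) v2, THE LEVELS PACKAGE (ℓ), numerics side
# «(ℓ)-NUMERICS» part 5b (cell gate-hubbard-kl, seat p4 g22): BLOCK 0's NUMERICS ROWS HAVE TIME-MESH-FREE RIGHT-HAND SIDES CARRYING `1/B`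

The closed assembly `kernelNormsLevels_all_klEng_final_rows_closed` (p3 g22, p699409) exposes block `0`'s numerics as hypothesis rows: five STRICT smallness rows
at every `λ_j`, `1 ≤ j ≤ d` (`4σ₀λQ′₀ < 1`, `2λτ₀Q′₀ ≤ 1`, `eτ₀λQ′₀ < 1`, `Φ₀(τ₀S₀(λ)) < 1`, the θ-row), the CE rows of the levels `j < d`, the DOMINATION of
the base read-out constants `Atot₁ ≤ Ab′ = Ab/B²`, `Qtot₁ ≤ Qb` by the main tower's amplitudes, and the kit guard `Φ₀·towerV D τ₀ μ̄ < 1`.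
On the reduced variable `r := β/M` block `0`'s pins are the main tower's (`σ₀ = s₀r²`, `τ₀ = t₀r²`, `ψ₀ = p₀/r²`, `Φ₀ = φ₀/r`, …NumericsPins), and its DATA
carry powers of `1/B` for free — the level-`0` datum law is supplied as `Ab₀ = ab₀·r/B²` (`exists_levelZeroBaseRows_klEng`: `A₁ε_x/Klam²/B²`), the
imports at `λ₁ = B·ε₁` are the `B`-free bounds at `ε₁` read with `ι₁₀′ = ι₁₀/B ≤ i₁₀/(B·r)`, `ι₂₀′ = ι₂₀/B ≤ i₂₀/(B·r³)`, and the Chernoff profile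
pinned on the datum (`A′₀ = 27⁵W₀Ab₀ ≤ aP₀·r/B²`, `Q′₀ = Z₀Qb₀ + 1 ≤ QH₀/r²`, `ι₃₀ = A′₀Q′₀³ ≤ i₃₀/(B²r⁵)`).  Consequences (pure real algebra):
* `levNum_S₀_le` — `S₀(λ) ≤ (i₁λ + i₂/(2QL) + i₃/(4QL²) + aP·QH/4)/(B·r)`;
* `levNum_y₀_le` — `Φ(τS) ≤ 1/2` from `λ ≤ 1/(4φ₀t₀i₁ + 1)` and `4φ₀t₀·ŝC ≤ B`;
* `levNum_x₃_le` — `eτλQ′ ≤ 1/2` and `2λτQ′ ≤ 1` from `λ ≤ 1/(2e·t₀QH + 1)` (`4σλQ′ ≤ 1/2` is …NumericsDoors' `levNum_x₁_le`);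
* `levNum_θ₀_le` — the θ-row `≤ λ·Θ ≤ 1/2` for `λ ≤ 1/(2Θ + 1)`, `Θ = eφ₀t₀i₁ + e²φ₀t₀²i₂ + e³φ₀t₀³i₃ + e³φ₀t₀³·aP·QH³`;
* `levNum_Atot₀_le` — **`Atot ≤ Cinc·(a_b + aP + e·φ₀t₀(i₁ + ŝC)²/QL)·r/B²`** (every block-0 read-out term carries `r/B²`: this is what makes the
  domination `Atot₁ ≤ Ab/B²` solvable by CHOOSING the main amplitude `Ab := aT₁·r`);
* `levNum_Qtot₀_le` — `Qtot·(r/2)² ≤ Dinc(1 + Dinc·qhi + 4QH + 2t₀p₀QH)/4`, i.e. `Qtot ≤ (…)/r²`;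
* `levNum_guard₀_lt` — the kit guard from the θ-row via the tree's `towerV_le_fourPiece` (…TowerChernoff).
Nothing about the model is asserted; nothing asserts (ℓ), any stub, K3 or superconductivity.
References: BGM 2006 §2.8 (2.83)–(2.84), (2.93)–(2.98), Lemma 2.5 (2.98) [cite: BenfattoGiulianiMastropietro2006].
-/

noncomputable section

namespace Summit.HubbardSuperconductivity.HubbardSuperconductivity.Theorems.EngineV8

set_option linter.dupNamespace false -- summit = problem name (single-conjunct summit), D-0017

open Real

section BlockZero

variable {r s₀ t₀ p₀ φ₀ σ τ ψ Φ Q' QL QH B lam ι₁ ι₂ ι₃ A' i₁ i₂ i₃ aP sC S : ℝ}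

/-- **Block 0's re-summed size from above**: `S = ι₁λ + ι₂/(2Q′) + ι₃/(4Q′²) + A′Q′/4` with `ι₁ ≤ i₁/(B·r)`, `0 ≤ ι₂ ≤ i₂/(B·r³)`, `0 ≤ ι₃ ≤ i₃/(B²·r⁵)`,
`0 ≤ A′ ≤ aP·r/B²`, `QL/r² ≤ Q′ ≤ QH/r²` (`QL > 0`), `1 ≤ B`, `0 ≤ λ` gives `S ≤ (i₁λ + i₂/(2QL) + i₃/(4QL²) + aP·QH/4)/(B·r)`. [folklore] -/
theorem levNum_S₀_le (hr : 0 < r) (hB : 1 ≤ B) (hQL : 0 < QL) (hlam : 0 ≤ lam) (hι₁ : ι₁ ≤ i₁ / (B * r)) (hι₂0 : 0 ≤ ι₂) (hι₂ : ι₂ ≤ i₂ / (B * r ^ 3))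
    (hι₃0 : 0 ≤ ι₃) (hι₃ : ι₃ ≤ i₃ / (B ^ 2 * r ^ 5)) (hA'0 : 0 ≤ A') (hA' : A' ≤ aP * r / B ^ 2) (hQ'₁ : QL / r ^ 2 ≤ Q') (hQ'₂ : Q' ≤ QH / r ^ 2) :
    ι₁ * lam + ι₂ / (2 * Q') + ι₃ / (4 * Q' ^ 2) + A' * Q' / 4 ≤ (i₁ * lam + i₂ / (2 * QL) + i₃ / (4 * QL ^ 2) + aP * QH / 4) / (B * r) := by
  have hB0 : 0 < B := by linarith
  have hBB : B ≤ B ^ 2 := by nlinarith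
  have hQ'0 : 0 < Q' := lt_of_lt_of_le (by positivity) hQ'₁
  have hQr : QL ≤ Q' * r ^ 2 := (div_le_iff₀ (by positivity)).1 hQ'₁
  have hQr' : Q' * r ^ 2 ≤ QH := (le_div_iff₀ (by positivity)).1 hQ'₂
  have hι₂r : ι₂ * (B * r ^ 3) ≤ i₂ := (le_div_iff₀ (by positivity)).1 hι₂
  have hι₃r : ι₃ * (B ^ 2 * r ^ 5) ≤ i₃ := (le_div_iff₀ (by positivity)).1 hι₃
  have hA'r : A' * B ^ 2 ≤ aP * r := (le_div_iff₀ (by positivity)).1 hA'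
  have haPr : 0 ≤ aP * r := le_trans (by positivity) hA'r
  have h1 : ι₁ * lam ≤ i₁ * lam / (B * r) := by
    rw [mul_div_right_comm]; exact mul_le_mul_of_nonneg_right hι₁ hlam
  have h2 : ι₂ / (2 * Q') ≤ i₂ / (2 * QL) / (B * r) := by
    rw [div_div, div_le_div_iff₀ (by positivity) (by positivity)]
    calc ι₂ * (2 * QL * (B * r)) ≤ ι₂ * (2 * (Q' * r ^ 2) * (B * r)) := by gcongr
      _ = ι₂ * (B * r ^ 3) * (2 * Q') := by ring
      _ ≤ i₂ * (2 * Q') := by gcongr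
  have h3 : ι₃ / (4 * Q' ^ 2) ≤ i₃ / (4 * QL ^ 2) / (B * r) := by
    have hQL2 : QL ^ 2 ≤ (Q' * r ^ 2) ^ 2 := pow_le_pow_left₀ hQL.le hQr 2
    rw [div_div, div_le_div_iff₀ (by positivity) (by positivity)]
    calc ι₃ * (4 * QL ^ 2 * (B * r)) ≤ ι₃ * (4 * (Q' * r ^ 2) ^ 2 * (B ^ 2 * r)) := by gcongr
      _ = ι₃ * (B ^ 2 * r ^ 5) * (4 * Q' ^ 2) := by ring
      _ ≤ i₃ * (4 * Q' ^ 2) := by gcongr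
  have h4 : A' * Q' / 4 ≤ aP * QH / 4 / (B * r) := by
    rw [div_div, div_le_div_iff₀ (by positivity) (by positivity)]
    refine le_of_mul_le_mul_right ?_ hr
    have hkey : A' * B ^ 2 * (Q' * r ^ 2) ≤ aP * r * QH := mul_le_mul hA'r hQr' (by positivity) haPr
    have hB1 : A' * B * (Q' * r ^ 2) ≤ A' * B ^ 2 * (Q' * r ^ 2) :=
      mul_le_mul_of_nonneg_right (mul_le_mul_of_nonneg_left hBB hA'0) (by positivity)
    calc A' * Q' * (4 * (B * r)) * r = 4 * (A' * B * (Q' * r ^ 2)) := by ring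
      _ ≤ 4 * (aP * r * QH) := by linarith [hB1.trans hkey]
      _ = aP * QH * 4 * r := by ring
  calc ι₁ * lam + ι₂ / (2 * Q') + ι₃ / (4 * Q' ^ 2) + A' * Q' / 4
      ≤ i₁ * lam / (B * r) + i₂ / (2 * QL) / (B * r) + i₃ / (4 * QL ^ 2) / (B * r) + aP * QH / 4 / (B * r) := by linarith
    _ = _ := by ring

/-- **Block 0's `y ≤ 1/2`**: `Φ = φ₀/r`, `τ = t₀r²`, `0 ≤ S ≤ (i₁λ + ŝC)/(B·r)`, `0 ≤ i₁`, `0 ≤ λ ≤ 1/(4φ₀t₀i₁ + 1)`, `4φ₀t₀·ŝC ≤ B`, `1 ≤ B` ⇒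
`0 ≤ Φ(τS) ≤ 1/2` (the `i₁λ` part by the coupling door, the rest by `B`). [folklore] -/
theorem levNum_y₀_le (hr : 0 < r) (ht₀ : 0 ≤ t₀) (hφ₀ : 0 ≤ φ₀) (hB : 1 ≤ B) (hΦ : Φ = φ₀ / r) (hτ : τ = t₀ * r ^ 2) (hS0 : 0 ≤ S)
    (hS : S ≤ (i₁ * lam + sC) / (B * r)) (hi₁ : 0 ≤ i₁) (hlam : 0 ≤ lam) (hlam4 : lam ≤ 1 / (4 * φ₀ * t₀ * i₁ + 1)) (hsC : 4 * φ₀ * t₀ * sC ≤ B) :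
    0 ≤ Φ * (τ * S) ∧ Φ * (τ * S) ≤ 1 / 2 := by
  have hB0 : 0 < B := by linarith
  have hBne : B ≠ 0 := hB0.ne'
  have hS' : S ≤ (i₁ * lam + sC / B) / r := by
    refine hS.trans ?_
    rw [div_le_div_iff₀ (by positivity) hr]
    have hexp : (i₁ * lam + sC / B) * (B * r) = (i₁ * lam * B + sC) * r := by
      calc (i₁ * lam + sC / B) * (B * r) = (i₁ * lam * B + sC / B * B) * r := by ring
        _ = (i₁ * lam * B + sC) * r := by rw [div_mul_cancel₀ sC hBne]
    rw [hexp]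
    have h1 : i₁ * lam ≤ i₁ * lam * B := le_mul_of_one_le_right (by positivity) hB
    have h2 : i₁ * lam + sC ≤ i₁ * lam * B + sC := by linarith
    exact mul_le_mul_of_nonneg_right h2 hr.le
  have hsmall : φ₀ * t₀ * (sC / B) ≤ 1 / 4 := by
    rw [mul_div_assoc', div_le_iff₀ hB0]; linarith
  exact levNum_y_le hr ht₀ hφ₀ hΦ hτ hS0 hS' hi₁ hlam4 hsmall

/-- **`x₃ ≤ 1/2` and `x₂ ≤ 1`**: `τ = t₀r²`, `0 < Q′ ≤ QH/r²`, `0 ≤ λ ≤ 1/(2e·t₀QH + 1)` ⇒ `0 ≤ eτλQ′ ≤ 1/2` and `2λτQ′ ≤ 1` (as `2 ≤ e`). [folklore] -/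
theorem levNum_x₃_le (hr : 0 < r) (ht₀ : 0 ≤ t₀) (hτ : τ = t₀ * r ^ 2) (hQ'0 : 0 < Q') (hQ'₂ : Q' ≤ QH / r ^ 2) (hlam0 : 0 ≤ lam)
    (hlam3 : lam ≤ 1 / (2 * exp 1 * t₀ * QH + 1)) :
    0 ≤ exp 1 * τ * lam * Q' ∧ exp 1 * τ * lam * Q' ≤ 1 / 2 ∧ 2 * lam * τ * Q' ≤ 1 := by
  have hQr' : Q' * r ^ 2 ≤ QH := (le_div_iff₀ (by positivity)).1 hQ'₂
  have hQH0 : 0 ≤ QH := le_trans (by positivity) hQr'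
  have hτ0 : 0 ≤ τ := by rw [hτ]; positivity
  have hx : exp 1 * τ * lam * Q' ≤ 1 / 2 := by
    have h1 : exp 1 * τ * lam * Q' = exp 1 * t₀ * (Q' * r ^ 2) * lam := by rw [hτ]; ring
    have h2 : exp 1 * t₀ * (Q' * r ^ 2) * lam ≤ exp 1 * t₀ * QH * lam := by gcongr
    have h3 : exp 1 * t₀ * QH * lam ≤ exp 1 * t₀ * QH * (1 / (2 * exp 1 * t₀ * QH + 1)) := by gcongr
    have h4 : exp 1 * t₀ * QH * (1 / (2 * exp 1 * t₀ * QH + 1)) ≤ 1 / 2 := by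
      rw [mul_one_div, div_le_iff₀ (by positivity)]; nlinarith [mul_nonneg (mul_nonneg (exp_pos 1).le ht₀) hQH0]
    linarith
  refine ⟨by positivity, hx, ?_⟩
  have he : (2 : ℝ) ≤ exp 1 := by have := Real.add_one_le_exp (1 : ℝ); linarith
  have h0 : 0 ≤ τ * lam * Q' := by positivity
  have h5 : 2 * lam * τ * Q' ≤ exp 1 * τ * lam * Q' := by
    calc 2 * lam * τ * Q' = 2 * (τ * lam * Q') := by ring
      _ ≤ exp 1 * (τ * lam * Q') := mul_le_mul_of_nonneg_right he h0
      _ = exp 1 * τ * lam * Q' := by ring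
  linarith

/-- **Block 0's θ-row**: with `Φ = φ₀/r`, `τ = t₀r²`, `0 ≤ ι₁ ≤ i₁/r`, `0 ≤ ι₂ ≤ i₂/r³`, `0 ≤ ι₃ ≤ i₃/r⁵`, `0 ≤ A′ ≤ aP·r`, `0 < Q′ ≤ QH/r²`, `0 ≤ λ ≤ 1` and
`x₃ = eτλQ′ ≤ 1/2`, the θ-row value `Φ·(eτ(ι₁λ) + (eτ)²(ι₂λ) + (eτ)³(ι₃λ²) + A′(eτQ′)·x₃³/(1 − x₃))` is `≥ 0` and `≤ λ·Θ`,
`Θ := e·φ₀t₀i₁ + e²·φ₀t₀²i₂ + e³·φ₀t₀³i₃ + e³·φ₀t₀³·aP·QH³`; hence `≤ 1/2` once `λ ≤ 1/(2Θ + 1)`. [folklore] -/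
theorem levNum_θ₀_le (hr : 0 < r) (ht₀ : 0 ≤ t₀) (hφ₀ : 0 ≤ φ₀) (hΦ : Φ = φ₀ / r) (hτ : τ = t₀ * r ^ 2)
    (hι₁0 : 0 ≤ ι₁) (hι₁ : ι₁ ≤ i₁ / r) (hι₂0 : 0 ≤ ι₂) (hι₂ : ι₂ ≤ i₂ / r ^ 3) (hι₃0 : 0 ≤ ι₃) (hι₃ : ι₃ ≤ i₃ / r ^ 5)
    (hA'0 : 0 ≤ A') (hA' : A' ≤ aP * r) (hQ'0 : 0 < Q') (hQ'₂ : Q' ≤ QH / r ^ 2) (hlam0 : 0 ≤ lam) (hlam1 : lam ≤ 1)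
    (hx₃ : exp 1 * τ * lam * Q' ≤ 1 / 2) {Θ : ℝ}
    (hΘ : Θ = exp 1 * φ₀ * t₀ * i₁ + exp 1 ^ 2 * φ₀ * t₀ ^ 2 * i₂ + exp 1 ^ 3 * φ₀ * t₀ ^ 3 * i₃ + exp 1 ^ 3 * φ₀ * t₀ ^ 3 * aP * QH ^ 3) :
    0 ≤ Φ * (exp 1 * τ * (ι₁ * lam) + (exp 1 * τ) ^ 2 * (ι₂ * lam) + (exp 1 * τ) ^ 3 * (ι₃ * lam ^ 2) +
        A' * (exp 1 * τ * Q') * ((exp 1 * τ * lam * Q') ^ 3 / (1 - exp 1 * τ * lam * Q'))) ∧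
      Φ * (exp 1 * τ * (ι₁ * lam) + (exp 1 * τ) ^ 2 * (ι₂ * lam) + (exp 1 * τ) ^ 3 * (ι₃ * lam ^ 2) +
        A' * (exp 1 * τ * Q') * ((exp 1 * τ * lam * Q') ^ 3 / (1 - exp 1 * τ * lam * Q'))) ≤ lam * Θ ∧
      (lam ≤ 1 / (2 * Θ + 1) → Φ * (exp 1 * τ * (ι₁ * lam) + (exp 1 * τ) ^ 2 * (ι₂ * lam) + (exp 1 * τ) ^ 3 * (ι₃ * lam ^ 2) +
        A' * (exp 1 * τ * Q') * ((exp 1 * τ * lam * Q') ^ 3 / (1 - exp 1 * τ * lam * Q'))) ≤ 1 / 2) := by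
  have hΦ0 : 0 ≤ Φ := by rw [hΦ]; positivity
  have hτ0 : 0 ≤ τ := by rw [hτ]; positivity
  have hx0 : 0 ≤ exp 1 * τ * lam * Q' := by positivity
  have hx1 : exp 1 * τ * lam * Q' < 1 := by linarith
  have hgeo0 : 0 ≤ (exp 1 * τ * lam * Q') ^ 3 / (1 - exp 1 * τ * lam * Q') := div_nonneg (by positivity) (by linarith)
  have hgeo : (exp 1 * τ * lam * Q') ^ 3 / (1 - exp 1 * τ * lam * Q') ≤ (exp 1 * τ * lam * Q') ^ 2 := by
    rw [div_le_iff₀ (by linarith)]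
    nlinarith [sq_nonneg (exp 1 * τ * lam * Q'), mul_nonneg (sq_nonneg (exp 1 * τ * lam * Q')) (by linarith : (0 : ℝ) ≤ 1 / 2 - exp 1 * τ * lam * Q')]
  have hι₁r : ι₁ * r ≤ i₁ := (le_div_iff₀ hr).1 hι₁
  have hι₂r : ι₂ * r ^ 3 ≤ i₂ := (le_div_iff₀ (by positivity)).1 hι₂
  have hι₃r : ι₃ * r ^ 5 ≤ i₃ := (le_div_iff₀ (by positivity)).1 hι₃
  have hQr' : Q' * r ^ 2 ≤ QH := (le_div_iff₀ (by positivity)).1 hQ'₂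
  have hi₁ : 0 ≤ i₁ := le_trans (by positivity) hι₁r
  have hi₂ : 0 ≤ i₂ := le_trans (by positivity) hι₂r
  have hi₃ : 0 ≤ i₃ := le_trans (by positivity) hι₃r
  have haPr : 0 ≤ aP * r := hA'0.trans hA'
  have haP : 0 ≤ aP := (mul_nonneg_iff_of_pos_right hr).1 haPr
  have hQH0 : 0 ≤ QH := le_trans (by positivity) hQr'
  have hΘ0 : 0 ≤ Θ := by rw [hΘ]; positivity
  have hlam2 : lam ^ 2 ≤ lam := by nlinarith
  -- the four terms
  have e1 : Φ * (exp 1 * τ * (ι₁ * lam)) = exp 1 * φ₀ * t₀ * (ι₁ * r) * lam := by rw [hΦ, hτ]; field_simp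
  have e2 : Φ * ((exp 1 * τ) ^ 2 * (ι₂ * lam)) = exp 1 ^ 2 * φ₀ * t₀ ^ 2 * (ι₂ * r ^ 3) * lam := by rw [hΦ, hτ]; field_simp
  have e3 : Φ * ((exp 1 * τ) ^ 3 * (ι₃ * lam ^ 2)) = exp 1 ^ 3 * φ₀ * t₀ ^ 3 * (ι₃ * r ^ 5) * lam ^ 2 := by rw [hΦ, hτ]; field_simp
  have e4 : Φ * (A' * (exp 1 * τ * Q') * (exp 1 * τ * lam * Q') ^ 2) = exp 1 ^ 3 * φ₀ * t₀ ^ 3 * (A' * r ^ 5 * Q' ^ 3) * lam ^ 2 := by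
    rw [hΦ, hτ]; field_simp
  have h4key : A' * r ^ 5 * Q' ^ 3 ≤ aP * QH ^ 3 := by
    refine le_of_mul_le_mul_right ?_ hr
    have hQ3 : (Q' * r ^ 2) ^ 3 ≤ QH ^ 3 := pow_le_pow_left₀ (by positivity) hQr' 3
    calc A' * r ^ 5 * Q' ^ 3 * r = A' * (Q' * r ^ 2) ^ 3 := by ring
      _ ≤ aP * r * QH ^ 3 := mul_le_mul hA' hQ3 (by positivity) haPr
      _ = aP * QH ^ 3 * r := by ring
  have h1 : Φ * (exp 1 * τ * (ι₁ * lam)) ≤ exp 1 * φ₀ * t₀ * i₁ * lam := by rw [e1]; gcongr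
  have h2 : Φ * ((exp 1 * τ) ^ 2 * (ι₂ * lam)) ≤ exp 1 ^ 2 * φ₀ * t₀ ^ 2 * i₂ * lam := by rw [e2]; gcongr
  have h3 : Φ * ((exp 1 * τ) ^ 3 * (ι₃ * lam ^ 2)) ≤ exp 1 ^ 3 * φ₀ * t₀ ^ 3 * i₃ * lam := by
    rw [e3]
    calc exp 1 ^ 3 * φ₀ * t₀ ^ 3 * (ι₃ * r ^ 5) * lam ^ 2 ≤ exp 1 ^ 3 * φ₀ * t₀ ^ 3 * i₃ * lam ^ 2 := by gcongr
      _ ≤ exp 1 ^ 3 * φ₀ * t₀ ^ 3 * i₃ * lam := mul_le_mul_of_nonneg_left hlam2 (by positivity)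
  have h4 : Φ * (A' * (exp 1 * τ * Q') * ((exp 1 * τ * lam * Q') ^ 3 / (1 - exp 1 * τ * lam * Q'))) ≤ exp 1 ^ 3 * φ₀ * t₀ ^ 3 * aP * QH ^ 3 * lam := by
    calc Φ * (A' * (exp 1 * τ * Q') * ((exp 1 * τ * lam * Q') ^ 3 / (1 - exp 1 * τ * lam * Q')))
        ≤ Φ * (A' * (exp 1 * τ * Q') * (exp 1 * τ * lam * Q') ^ 2) := by gcongr
      _ = exp 1 ^ 3 * φ₀ * t₀ ^ 3 * (A' * r ^ 5 * Q' ^ 3) * lam ^ 2 := e4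
      _ ≤ exp 1 ^ 3 * φ₀ * t₀ ^ 3 * (aP * QH ^ 3) * lam ^ 2 := by gcongr
      _ ≤ exp 1 ^ 3 * φ₀ * t₀ ^ 3 * (aP * QH ^ 3) * lam := mul_le_mul_of_nonneg_left hlam2 (by positivity)
      _ = exp 1 ^ 3 * φ₀ * t₀ ^ 3 * aP * QH ^ 3 * lam := by ring
  have hsum : Φ * (exp 1 * τ * (ι₁ * lam) + (exp 1 * τ) ^ 2 * (ι₂ * lam) + (exp 1 * τ) ^ 3 * (ι₃ * lam ^ 2) +
      A' * (exp 1 * τ * Q') * ((exp 1 * τ * lam * Q') ^ 3 / (1 - exp 1 * τ * lam * Q'))) ≤ lam * Θ := by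
    rw [hΘ]
    calc Φ * (exp 1 * τ * (ι₁ * lam) + (exp 1 * τ) ^ 2 * (ι₂ * lam) + (exp 1 * τ) ^ 3 * (ι₃ * lam ^ 2) +
          A' * (exp 1 * τ * Q') * ((exp 1 * τ * lam * Q') ^ 3 / (1 - exp 1 * τ * lam * Q')))
        = Φ * (exp 1 * τ * (ι₁ * lam)) + Φ * ((exp 1 * τ) ^ 2 * (ι₂ * lam)) + Φ * ((exp 1 * τ) ^ 3 * (ι₃ * lam ^ 2)) +
          Φ * (A' * (exp 1 * τ * Q') * ((exp 1 * τ * lam * Q') ^ 3 / (1 - exp 1 * τ * lam * Q'))) := by ring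
      _ ≤ exp 1 * φ₀ * t₀ * i₁ * lam + exp 1 ^ 2 * φ₀ * t₀ ^ 2 * i₂ * lam + exp 1 ^ 3 * φ₀ * t₀ ^ 3 * i₃ * lam +
          exp 1 ^ 3 * φ₀ * t₀ ^ 3 * aP * QH ^ 3 * lam := add_le_add (add_le_add (add_le_add h1 h2) h3) h4
      _ = lam * (exp 1 * φ₀ * t₀ * i₁ + exp 1 ^ 2 * φ₀ * t₀ ^ 2 * i₂ + exp 1 ^ 3 * φ₀ * t₀ ^ 3 * i₃ + exp 1 ^ 3 * φ₀ * t₀ ^ 3 * aP * QH ^ 3) := by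
          ring
  refine ⟨by positivity, hsum, fun hlamΘ => hsum.trans ?_⟩
  calc lam * Θ ≤ 1 / (2 * Θ + 1) * Θ := mul_le_mul_of_nonneg_right hlamΘ hΘ0
    _ ≤ 1 / 2 := by rw [one_div_mul_eq_div, div_le_iff₀ (by positivity)]; linarith

/-- **Block 0's read-out amplitude `Atot ≤ aT·r/B²`** (the located «(ℓ)-BLOCK0-DOMINATION» fixed point, solved): from the geometric ratios `x₁ ≤ 1/2`,
`y = Φ(τS) ≤ 1/2`, `0 ≤ S ≤ (i₁ + ŝC)/(B·r)`, `QL/r² ≤ Q′` (`QL > 0`), `0 ≤ A′ ≤ aP·r/B²`, `Ab = a_b·r/B²`, `Aro = Cinc·Ab`, `Φ = φ₀/r`, `τ = t₀r²`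
(`t₀ > 0`): `Atot ≤ Cinc·(a_b + aP + e·φ₀t₀·(i₁ + ŝC)²/QL)·r/B²`. [cite: BenfattoGiulianiMastropietro2006, §2.8 (2.93)-(2.98)] -/
theorem levNum_Atot₀_le {Cinc Ab a_b Aro Atot : ℝ} (hr : 0 < r) (ht₀ : 0 < t₀) (hφ₀ : 0 ≤ φ₀) (hB : 1 ≤ B) (hΦ : Φ = φ₀ / r) (hτ : τ = t₀ * r ^ 2)
    (hQL : 0 < QL) (hQ'₁ : QL / r ^ 2 ≤ Q') (hS0 : 0 ≤ S) (hS' : S ≤ (i₁ + sC) / (B * r))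
    (hx₁ : 4 * σ * lam * Q' ≤ 1 / 2) (hy : Φ * (τ * S) ≤ 1 / 2)
    (hA'0 : 0 ≤ A') (hA' : A' ≤ aP * r / B ^ 2) (hAb : Ab = a_b * r / B ^ 2) (hCinc : 0 ≤ Cinc) (hAro : Aro = Cinc * Ab)
    (hAtot : Atot = Aro + Cinc * (A' * (4 * σ * lam * Q' / (1 - 4 * σ * lam * Q')) +
      exp 1 * (τ * S) * (Φ * (τ * S) / (1 - Φ * (τ * S))) / (2 * τ * Q'))) :
    Atot ≤ Cinc * (a_b + aP + exp 1 * φ₀ * t₀ * (i₁ + sC) ^ 2 / QL) * r / B ^ 2 := by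
  have hB0 : 0 < B := by linarith
  have hQ'0 : 0 < Q' := lt_of_lt_of_le (by positivity) hQ'₁
  have hQr : QL ≤ Q' * r ^ 2 := (div_le_iff₀ (by positivity)).1 hQ'₁
  have hτ0 : 0 < τ := by rw [hτ]; positivity
  have hΦ0 : 0 ≤ Φ := by rw [hΦ]; positivity
  have hy0 : 0 ≤ Φ * (τ * S) := by positivity
  have hSr : S * (B * r) ≤ i₁ + sC := (le_div_iff₀ (by positivity)).1 hS'
  have hSr0 : 0 ≤ S * (B * r) := by positivity
  -- the two geometric ratios
  have hgeo₁ : A' * (4 * σ * lam * Q' / (1 - 4 * σ * lam * Q')) ≤ aP * r / B ^ 2 :=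
    (mul_le_of_le_one_right hA'0 (levNum_geom_le_one hx₁)).trans hA'
  have hgeo₂' : Φ * (τ * S) / (1 - Φ * (τ * S)) ≤ 2 * (Φ * (τ * S)) := by
    rw [div_le_iff₀ (by linarith)]
    nlinarith [mul_nonneg hy0 (sub_nonneg.2 hy)]
  have hgeo₂ : exp 1 * (τ * S) * (Φ * (τ * S) / (1 - Φ * (τ * S))) / (2 * τ * Q') ≤ exp 1 * φ₀ * t₀ * (i₁ + sC) ^ 2 / QL * r / B ^ 2 := by
    calc exp 1 * (τ * S) * (Φ * (τ * S) / (1 - Φ * (τ * S))) / (2 * τ * Q')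
        ≤ exp 1 * (τ * S) * (2 * (Φ * (τ * S))) / (2 * τ * Q') := by gcongr
      _ = exp 1 * Φ * τ * S ^ 2 / Q' := by field_simp
      _ = exp 1 * φ₀ * t₀ * (S * (B * r)) ^ 2 / (Q' * r ^ 2) * r / B ^ 2 := by rw [hΦ, hτ]; field_simp
      _ ≤ exp 1 * φ₀ * t₀ * (i₁ + sC) ^ 2 / (Q' * r ^ 2) * r / B ^ 2 := by gcongr
      _ ≤ exp 1 * φ₀ * t₀ * (i₁ + sC) ^ 2 / QL * r / B ^ 2 := by gcongr
  have h2 := mul_le_mul_of_nonneg_left (add_le_add hgeo₁ hgeo₂) hCinc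
  have hsplit : Cinc * (a_b + aP + exp 1 * φ₀ * t₀ * (i₁ + sC) ^ 2 / QL) * r / B ^ 2
      = Cinc * (a_b * r / B ^ 2) + Cinc * (aP * r / B ^ 2 + exp 1 * φ₀ * t₀ * (i₁ + sC) ^ 2 / QL * r / B ^ 2) := by ring
  rw [hsplit, hAtot, hAro, hAb]
  linarith [h2]

/-- **Block 0's per-leg-pair constant**: `Qro = Dinc·Qb`, `Qtot = Dinc·max 1 (max Qro (max (4Q′) (2τψQ′)))`, `τ = t₀r²`, `ψ = p₀/r²`, `0 < Q′ ≤ QH/r²`,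
`0 ≤ Qb ≤ qhi/r²`, `1 ≤ Dinc`, `0 < r ≤ 1` ⇒ `0 ≤ Qtot`, `Qtot·(r/2)² ≤ Dinc(1 + Dinc·qhi + 4QH + 2t₀p₀QH)/4` and
`Qtot ≤ Dinc(1 + Dinc·qhi + 4QH + 2t₀p₀QH)/r²`. [folklore] -/
theorem levNum_Qtot₀_le {Dinc Qb qhi Qro Qtot : ℝ} (hr : 0 < r) (hr1 : r ≤ 1) (ht₀ : 0 ≤ t₀) (hp₀ : 0 ≤ p₀) (hτ : τ = t₀ * r ^ 2)
    (hψ : ψ = p₀ / r ^ 2) (hQ'0 : 0 < Q') (hQ'₂ : Q' ≤ QH / r ^ 2) (hQb0 : 0 ≤ Qb) (hQb : Qb ≤ qhi / r ^ 2) (hDinc : 1 ≤ Dinc)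
    (hQro : Qro = Dinc * Qb) (hQtot : Qtot = Dinc * max 1 (max Qro (max (4 * Q') (2 * τ * ψ * Q')))) :
    0 ≤ Qtot ∧ Qtot * (r / 2) ^ 2 ≤ Dinc * (1 + Dinc * qhi + 4 * QH + 2 * t₀ * p₀ * QH) / 4 ∧
      Qtot ≤ Dinc * (1 + Dinc * qhi + 4 * QH + 2 * t₀ * p₀ * QH) / r ^ 2 := by
  have hQr' : Q' * r ^ 2 ≤ QH := (le_div_iff₀ (by positivity)).1 hQ'₂
  have hQbr : Qb * r ^ 2 ≤ qhi := (le_div_iff₀ (by positivity)).1 hQb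
  have hD0 : 0 ≤ Dinc := by linarith
  have hQtot0 : 0 ≤ Qtot := by rw [hQtot]; exact mul_nonneg hD0 (le_trans zero_le_one (le_max_left _ _))
  have hτψ : 2 * τ * ψ * Q' = 2 * t₀ * p₀ * Q' := by rw [hτ, hψ]; field_simp
  have hQro0 : 0 ≤ Qro := by rw [hQro]; positivity
  have hQro' : Qro * r ^ 2 ≤ Dinc * qhi := by
    rw [hQro]
    calc Dinc * Qb * r ^ 2 = Dinc * (Qb * r ^ 2) := by ring
      _ ≤ Dinc * qhi := by gcongr
  have hr2 : r ^ 2 ≤ 1 := pow_le_one₀ hr.le hr1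
  have h4 : 0 ≤ 4 * Q' := by positivity
  have h5 : 0 ≤ 2 * τ * ψ * Q' := by rw [hτψ]; positivity
  have h1 : max 1 (max Qro (max (4 * Q') (2 * τ * ψ * Q'))) ≤ 1 + Qro + 4 * Q' + 2 * τ * ψ * Q' :=
    max_le (by linarith) (max_le (by linarith) (max_le (by linarith) (by linarith)))
  have hm : max 1 (max Qro (max (4 * Q') (2 * τ * ψ * Q'))) * r ^ 2 ≤ 1 + Dinc * qhi + 4 * QH + 2 * t₀ * p₀ * QH := by
    calc max 1 (max Qro (max (4 * Q') (2 * τ * ψ * Q'))) * r ^ 2 ≤ (1 + Qro + 4 * Q' + 2 * τ * ψ * Q') * r ^ 2 :=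
          mul_le_mul_of_nonneg_right h1 (by positivity)
      _ = r ^ 2 + Qro * r ^ 2 + 4 * (Q' * r ^ 2) + 2 * t₀ * p₀ * (Q' * r ^ 2) := by rw [hτψ]; ring
      _ ≤ 1 + Dinc * qhi + 4 * QH + 2 * t₀ * p₀ * QH := by gcongr
  have hmain : Qtot * r ^ 2 ≤ Dinc * (1 + Dinc * qhi + 4 * QH + 2 * t₀ * p₀ * QH) := by
    rw [hQtot]
    calc Dinc * max 1 (max Qro (max (4 * Q') (2 * τ * ψ * Q'))) * r ^ 2 = Dinc * (max 1 (max Qro (max (4 * Q') (2 * τ * ψ * Q'))) * r ^ 2) := by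
          ring
      _ ≤ Dinc * (1 + Dinc * qhi + 4 * QH + 2 * t₀ * p₀ * QH) := by gcongr
  refine ⟨hQtot0, ?_, ?_⟩
  · calc Qtot * (r / 2) ^ 2 = Qtot * r ^ 2 / 4 := by ring
      _ ≤ Dinc * (1 + Dinc * qhi + 4 * QH + 2 * t₀ * p₀ * QH) / 4 := by gcongr
  · rw [le_div_iff₀ (by positivity)]; exact hmain

/-- **Block 0's kit guard from the θ-row**: `0 ≤ Φ`, the four-piece Chernoff rows of `μ̄` at `λ` (`μ̄ 1 ≤ ι₁λ`, `μ̄ 2 ≤ ι₂λ`, `μ̄ 3 ≤ ι₃λ²`,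
`μ̄ m ≤ A′λ^{m−1}Q′^m` for `4 ≤ m ≤ D`), `x₃ = eτλQ′ < 1` and the θ-row value `≤ 1/2` give `Φ·towerV D τ μ̄ < 1` (tree `towerV_le_fourPiece`).
[cite: BenfattoGiulianiMastropietro2006, §2.8 (2.83)-(2.84)] -/
theorem levNum_guard₀_lt {D : ℕ} {μ : ℕ → ℝ} (hΦ0 : 0 ≤ Φ) (hτ0 : 0 ≤ τ) (hlam0 : 0 ≤ lam) (hQ'0 : 0 ≤ Q') (hA'0 : 0 ≤ A')
    (hμ0 : ∀ m, 0 ≤ μ m) (hμ1 : μ 1 ≤ ι₁ * lam) (hμ2 : μ 2 ≤ ι₂ * lam) (hμ3 : μ 3 ≤ ι₃ * lam ^ 2)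
    (hprof : ∀ m, 4 ≤ m → m ≤ D → μ m ≤ A' * lam ^ (m - 1) * Q' ^ m) (hx₃ : exp 1 * τ * lam * Q' < 1)
    (hθ : Φ * (exp 1 * τ * (ι₁ * lam) + (exp 1 * τ) ^ 2 * (ι₂ * lam) + (exp 1 * τ) ^ 3 * (ι₃ * lam ^ 2) +
      A' * (exp 1 * τ * Q') * ((exp 1 * τ * lam * Q') ^ 3 / (1 - exp 1 * τ * lam * Q'))) ≤ 1 / 2) :
    Φ * towerV D τ μ < 1 := by
  have h := towerV_le_fourPiece hτ0 hlam0 hQ'0 hA'0 hμ0 hμ1 hμ2 hμ3 hprof hx₃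
  have h2 := mul_le_mul_of_nonneg_left h hΦ0
  linarith

end BlockZero

end Summit.HubbardSuperconductivity.HubbardSuperconductivity.Theorems.EngineV8

end
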